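import Summits.QuantumAdvantage.QuantumAdvantage.Theorems.LinnikCubicClassGroupsDegreeOnePrimesEscapeRayClassWindowSmoothed
import Summits.QuantumAdvantage.QuantumAdvantage.Theorems.LinnikCubicClassGroupsDegreeOnePrimesEscapeRayClassDHInputs
import Summits.QuantumAdvantage.QuantumAdvantage.Theorems.LinnikCubicClassGroupsDegreeOnePrimesEscapeFrobeniusWindowBookkeeping
import Summits.QuantumAdvantage.QuantumAdvantage.Theorems.LinnikCubicClassGroupsDegreeOnePrimesEscapeShortIntervalSmoothed
import Summits.QuantumAdvantage.QuantumAdvantage.Theorems.LinnikCubicClassGroupsDegreeOnePrimesEscapeHeckeWindow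
import Literature.NumberTheory.LFunctions.EntireFamilyWindowZeroSum
import HarnessLib

/-!
# Short intervals for cosets of a congruence class group, II: the core window estimate with a prescribed zero-free
# region (Deuring–Heilbronn input)

Topic `Summits/QuantumAdvantage/QuantumAdvantage/Theorems`, cell B2b-1 (linnik-cubic), PART A (gen 23); helper toward
the crux `DegreeOnePrimesEscape` (stmt-QuantumAdvantage-11543) of route `LinnikCubicClassGroups` — the ray-class
counterpart of `classWindow_core_dh` (gen 19).  HONEST FRAMING: the value of this file is a THEOREM (kernel-checked
lemma) — NOT summit progress.

`rayWindow_core_dh`: for a number field `K` of degree `n > 1`, an abelian Frobenius datum `f : 𝔭 ↦ f 𝔭 ∈ G` killing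
the narrow ray `mod 𝔪 ≠ 0` (non-trivial characters non-principal off `𝔪`), a size parameter `Q ≥ Q_𝔪 = rayCondQ K 𝔪`
with `|G| ≤ Q⁴`, the log-free density bound for the family `F_ψ = rayFamF … ψ` in `Q`-form (constants `b, D, a`), a
zero-free region of constant `c_Z` off the exceptional segment `rayExcRegion c K 𝔪` up to height `T₁ = X^θ` (a
HYPOTHESIS, supplied by Landau–Page or by Deuring–Heilbronn), `0 < θ ≤ 1/8`, `θb ≤ 1/8`, `x > 1`, `a log Q ≤ θ log x`,
`2 ≤ θ log x`, `0 < η ≤ log 2` with `x^{−θ/8} ≤ 2η`, collar `ε = ε₀η` (`0 < ε₀ ≤ 1/4`), secondary terms bounded by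
`κ₂` (`hjunk`) and the imprimitive correction bounded by `κ₃` (`hjunk'`): for every window
`log x ≤ lo < hi ≤ log x + η` (`g = windowTest lo hi (ε₀η)`, `F` its Laplace transform), every coset `τ` and all
admissible exceptional sets `Exc ψ`,
`‖|G| ψ̃_τ(g) − F(−1) + Σ_ψ ψ(τ)⁻¹ Σ_{ρ ∈ Exc ψ} m_ψ(ρ) F(−ρ)‖ ≤ ((9/2)·2eD e^{−c_Z/(6θ)} + κ₂ + κ₃)·x·η`.
Ingredients: the window explicit-formula reading `norm_card_mul_smoothedPsiFiber_window_sub_le` (file I), the abstract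
window zero sum `family_zeroSum_window_le_zfr` (`EntireFamilyWindowZeroSum`), the window bounds `rayFam_window`, the
left-line bounds `norm_dzEFRemainder_windowTest_zero_le` / `norm_rcEFRemainder_windowTest_zero_le`, and the real
bookkeeping `frobWindow_bookkeeping` (gen 17).
References: G. Hoheisel (1930); [LagariasMontgomeryOdlyzko1979, §7]; [ThornerZaman2019, Thm. 3.1, §5];
[ThornerZaman2017, §8].
-/

noncomputable section

open Complex Real MeasureTheory Set Filter Topology NumberField IsDedekindDomain
open scoped NumberField nonZeroDivisors

namespace Summit.QuantumAdvantage.QuantumAdvantage.Theorems.DegreeOnePrimesEscape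

open Literature.NumberTheory.LFunctions Literature.NumberTheory.LFunctions.NumberField
  Literature.NumberTheory.LFunctions.EntireEF Literature.NumberTheory.LFunctions.WindowWeight
  Literature.NumberTheory.LFunctions.AbelianDensity
open scoped Classical

variable {K : Type} [Field K] [NumberField K]
variable {G : Type} [CommGroup G] [Finite G] {𝔪 : Ideal (𝓞 K)} {f : HeightOneSpectrum (𝓞 K) → G}
variable (h𝔪 : 𝔪 ≠ ⊥) (hray : ArtinKillsRay 𝔪 f)
  (hsep : ∀ χ : AddChar (Additive G) ℂ, χ ≠ 0 →
    ∃ v : HeightOneSpectrum (𝓞 K), ¬ 𝔪 ≤ v.asIdeal ∧ χ (Additive.ofMul (f v)) ≠ 1)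

set_option maxHeartbeats 1600000 in
/-- **The core window estimate for the smoothed coset sum, with a prescribed zero-free region and a general collar**
(see the module docstring). [cite: LagariasMontgomeryOdlyzko1979, §7] [cite: ThornerZaman2019, §5] -/
theorem rayWindow_core_dh {n : ℕ} (hn : 1 < n) (hKn : Module.finrank ℚ K = n)
    {b D a : ℝ} (hb : 0 < b) (hD : 0 < D) (ha : 1 ≤ a)
    {Q : ℝ} (hQK : rayCondQ K 𝔪 ≤ Q) (hG : (Nat.card G : ℝ) ≤ Q ^ (4 : ℕ))
    (hdens : ∀ (T : ℝ), 1 ≤ T → ∀ u : AddChar (Additive G) ℂ → Finset ℂ,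
        (∀ ψ, ∀ ρ ∈ u ψ, rayFamF h𝔪 hray hsep ψ ρ = 0 ∧ 1 / 4 ≤ ρ.re ∧ ρ.re < 1 ∧ |ρ.im| ≤ T) →
        ∀ α : ℝ, α ≤ 1 →
          ∑ ψ, ∑ ρ ∈ u ψ with α ≤ ρ.re, (analyticOrderNatAt (rayFamF h𝔪 hray hsep ψ) ρ : ℝ) ≤
            D * Real.exp (b * (a * Real.log Q + Real.log (T + 4))) ^ (1 - α))
    (c : ℝ) {cZ : ℝ} (hcZ : 0 < cZ)
    {M : ℝ} (hM1 : 1 ≤ M)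
    (hM : ∀ y : ℝ, |iteratedDeriv 1 Real.smoothTransition y| ≤ M ∧ |iteratedDeriv 2 Real.smoothTransition y| ≤ M)
    {Al : ℝ} (hAl0 : 0 < Al)
    (hAl : ∀ (K' : Type) [Field K'] [NumberField K'] (χ : ClassGroup (𝓞 K') →* ℂˣ) (t : ℝ),
      ‖logDeriv (classGroupLFunction K' χ) (-1 / 2 + t * I)‖ ≤
        Al * (Module.finrank ℚ K' + 1) * (Real.log ((NumberField.discr K').natAbs : ℝ) + Real.log (|t| + 4)))
    {Cr : ℝ} (hCr0 : 0 < Cr)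
    (hCr : ∀ (K' : Type) [Field K'] [NumberField K'] (𝔪' : Ideal (𝓞 K'))
      (ψ : HeightOneSpectrum (𝓞 K') → ℂ) (p : Finset {w : InfinitePlace K' // w.IsReal}),
      IsRayClassCharacter 𝔪' ψ → IsPrimitive 𝔪' ψ → IsSignType 𝔪' ψ p → 𝔪' ≠ ⊥ →
      ∀ (L L' : ℂ → ℂ), Differentiable ℂ L → (∀ s : ℂ, 1 < s.re → L s = rayClassLSeries 𝔪' ψ s) →
        Differentiable ℂ L' → (∀ s : ℂ, 1 < s.re → L' s = rayClassLSeries 𝔪' (star ψ) s) →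
      ∀ t : ℝ, ‖logDeriv L (-1 / 2 + t * I)‖ ≤
        Cr * (Module.finrank ℚ K' + 1) * (Real.log (|(discr K' : ℝ)| * (Ideal.absNorm 𝔪' : ℝ)) + Real.log (|t| + 4)))
    {θ : ℝ} (hθ0 : 0 < θ) (hθb : θ * b ≤ 1 / 8) (hθ1 : θ ≤ 1 / 8)
    {x η : ℝ} (hx1 : 1 < x)
    (haθ : a * Real.log Q ≤ θ * Real.log x) (h2θ : 2 ≤ θ * Real.log x)
    (hη0 : 0 < η) (hη1 : η ≤ Real.log 2) (hηx : Real.exp (-(θ / 8) * Real.log x) ≤ 2 * η)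
    {lo hi : ℝ} (hlo : Real.log x ≤ lo) (hlohi : lo < hi) (hhi : hi ≤ Real.log x + η)
    {ε₀ : ℝ} (hε₀0 : 0 < ε₀) (hε₀1 : ε₀ ≤ 1 / 4) {κ₂ κ₃ : ℝ}
    (hjunk : (338 * (512 * ((n : ℝ) + 1)) + 96 * (M / (4 * ε₀)) * (512 * ((n : ℝ) + 1)) *
        (4 * tailConst₁ + tailConst₂) + 108 + 640 * leftLineConst * (max Al Cr) * (M / (4 * ε₀))) *
        Q ^ (7 : ℕ) * (Real.log x + 1) * Real.exp (-(θ / 4) * Real.log x) ≤ κ₂)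
    (hjunk' : (Nat.card G : ℝ) * (2 * (Real.log x + η + 2) * Real.log (Ideal.absNorm 𝔪 : ℕ)) ≤ κ₃ * x * η)
    (hzfr : ∀ (ψ : AddChar (Additive G) ℂ) (ρ : ℂ), rayFamF h𝔪 hray hsep ψ ρ = 0 → 1 / 4 ≤ ρ.re →
        ρ.re < 1 → |ρ.im| ≤ Real.exp (θ * (hi + ε₀ * η)) → ¬ rayExcRegion c K 𝔪 ρ →
          ρ.re ≤ 1 - cZ / (a * Real.log Q + Real.log (|ρ.im| + 4)))
    (τ : G) (Exc : AddChar (Additive G) ℂ → Finset ℂ)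
    (hExc : ∀ ψ, ∀ ρ ∈ Exc ψ, rayFamF h𝔪 hray hsep ψ ρ = 0 ∧ 0 < ρ.re ∧ ρ.re < 1)
    (hExc' : ∀ ψ ρ, rayFamF h𝔪 hray hsep ψ ρ = 0 → 0 < ρ.re → ρ.re < 1 → rayExcRegion c K 𝔪 ρ → ρ ∈ Exc ψ) :
    ‖(Nat.card G : ℂ) * (smoothedPsiFiber 𝔪 f τ (windowTest lo hi (ε₀ * η)) : ℂ) -
        fordLaplace (windowTest lo hi (ε₀ * η)) (-1) +
        ∑ ψ : AddChar (Additive G) ℂ, (ψ (Additive.ofMul τ))⁻¹ *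
          ∑ ρ ∈ Exc ψ, (analyticOrderNatAt (rayFamF h𝔪 hray hsep ψ) ρ : ℂ) *
            fordLaplace (windowTest lo hi (ε₀ * η)) (-ρ)‖ ≤
      (9 / 2 * (2 * Real.exp 1 * D * Real.exp (-(cZ / (6 * θ)))) + κ₂ + κ₃) * x * η := by
  obtain ⟨hc₁16, hc₂0⟩ := tailConst_nonneg
  have hlC := leftLineConst_nonneg
  have hK : 1 < Module.finrank ℚ K := by rw [hKn]; exact hn
  obtain ⟨hQ12, hdQ, hlogd0, hlogdQ, hlogQ1, hnQ, -⟩ := raySize_facts h𝔪 hK hQK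
  have hQ0 : (0 : ℝ) < Q := by linarith
  have hlogQ2 : 2 ≤ Real.log Q := two_lt_log_twelve.le.trans (Real.log_le_log (by norm_num) hQ12)
  have hx0 : 0 < x := by linarith
  have hL0 : 0 < Real.log x := Real.log_pos hx1
  have hxexp : Real.exp (Real.log x) = x := Real.exp_log hx0
  have hM0 : 0 ≤ M := by linarith
  have hAC0 : 0 < max Al Cr := lt_max_of_lt_left hAl0
  -- `L ≥ 16`, hence `ε = ε₀ η ≤ η/4 < lo`, `ε ≤ 1`
  have hlog2 : Real.log 2 < 0.6931471808 := Real.log_two_lt_d9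
  have hθL8 : θ * Real.log x ≤ Real.log x / 8 := by
    have := mul_le_mul_of_nonneg_right hθ1 hL0.le; linarith
  set ε : ℝ := ε₀ * η with hε
  have hε0 : 0 < ε := by positivity
  have hε4 : ε ≤ η / 4 := by
    rw [hε]; have := mul_le_mul_of_nonneg_right hε₀1 hη0.le; linarith
  have hεlo : ε < lo := by linarith
  have hε1 : ε ≤ 1 := by linarith
  have hℓ0 : 0 < hi - lo + 2 * ε := by linarith
  have hLX0 : 0 ≤ hi + ε := by linarith
  have hT₁1 : 1 ≤ Real.exp (θ * (hi + ε)) := Real.one_le_exp (mul_nonneg hθ0.le hLX0)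
  -- the range condition
  have hrange : Real.exp (b * (a * Real.log Q + Real.log (Real.exp (θ * (hi + ε)) + 4))) ≤
      Real.exp (hi + ε) ^ ((1 : ℝ) / 2) :=
    frobWindow_range (LX := hi + ε) hb hθ0 hθb hθ1 haθ h2θ hlo hlohi hε0 rfl rfl
  -- window data
  set W₀ : ℝ := 512 * ((n : ℝ) + 1) with hW₀
  have hW₀0 : 0 < W₀ := by positivity
  set logd : ℝ := Real.log (((discr K).natAbs : ℝ) * ((Ideal.absNorm 𝔪 : ℕ) : ℝ)) with hlogd
  set AK : ℝ := logd + 3 * (n : ℝ) with hAKdef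
  have hAK4 : AK ≤ 4 * Q := by
    have h := windowConst_le_rayCondQ (K := K) h𝔪
    rw [hKn] at h
    rw [hAKdef, hlogd]; linarith
  have hAnn : 0 ≤ AK := by rw [hAKdef]; positivity
  have hwin : ∀ (ψ : AddChar (Additive G) ℂ) (τ' : ℝ) (P : Finset ℂ),
      (∀ ρ ∈ P, rayFamF h𝔪 hray hsep ψ ρ = 0 ∧ 0 < ρ.re ∧ ρ.re < 1 ∧ |ρ.im - τ'| ≤ 1 / 2) →
      ∑ ρ ∈ P, (analyticOrderNatAt (rayFamF h𝔪 hray hsep ψ) ρ : ℝ) ≤ W₀ * (AK + Real.log (|τ'| + 4)) := by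
    intro ψ τ' P hP
    have hw := rayFam_window h𝔪 hray hsep ψ τ' P hP
    rw [hKn] at hw
    rw [hW₀, hAKdef, hlogd]
    exact hw
  have h𝓠1 : 1 ≤ a * Real.log Q := by nlinarith
  have hcardG : (Fintype.card (AddChar (Additive G) ℂ) : ℝ) = Nat.card G := by
    rw [card_addChar_eq_natCard]
  -- the two-sided smoothed estimate with the exceptional zeros `Exc` and the ZFR constant `c_Z`
  have hsm := norm_card_mul_smoothedPsiFiber_window_sub_le h𝔪 hray hsep (c := c) hε0 hε1 hεlo hlohi τ
    Exc hExc hExc'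
    (fun u hu ↦ family_zeroSum_window_le_zfr (differentiable_rayFamF h𝔪 hray hsep)
      (rayFamF_two_ne_zero h𝔪 hray hsep) hb hD h𝓠1 hdens hW₀0.le hAnn hwin (rayExcRegion c K 𝔪) hcZ hM hε0
      hεlo hlohi hT₁1 hzfr hrange u hu)
    (M₀ := 64 * Q * (hi - lo + 2 * ε))
    (fun ψ ↦ ?_)
    (J := leftLineConst * (max Al Cr * ((n : ℝ) + 1)) * (logd + Real.log 4 + 1) *
      (Real.exp (-((lo - ε) / 2)) * (2 * M / ε)))
    ?_ (fun ψ hψ ↦ ?_)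
  rotate_left
  · -- the trivial-zero multiplicities: `m_ψ(0) ≤ 64 Q`
    have hm : (analyticOrderNatAt (rayFamF h𝔪 hray hsep ψ) 0 : ℝ) ≤ 64 * Q := by
      by_cases hψ : ψ = 0
      · subst hψ
        rw [rayFamF_zero]
        refine (analyticOrderNatAt_dedekindZeta₁_zero_le (K := K)).trans ?_
        have hd1 : (1 : ℝ) ≤ ((discr K).natAbs : ℝ) := by exact_mod_cast Int.natAbs_pos.mpr (discr_ne_zero K)
        have hm1 := one_le_absNorm_cast h𝔪
        have hle : Real.log ((discr K).natAbs : ℝ) ≤ logd := by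
          rw [hlogd]; exact Real.log_le_log (by linarith) (by nlinarith)
        have : (Module.finrank ℚ K : ℝ) ≤ Q := hnQ
        linarith
      · set Dψ := datumData h𝔪 hray hsep ψ hψ with hDψ
        rw [rayFamF_of_ne h𝔪 hray hsep hψ]
        have hnt := charFun_nontrivial hsep hψ
        have hm₀ := analyticOrderNatAt_continuation_zero_le Dψ.isRayClassCharacter Dψ.isPrimitive Dψ.isSignType
          Dψ.ne_bot (Dψ.nontrivial hnt) Dψ.differentiable Dψ.L_eq
        have hdisc : |(discr K : ℝ)| = ((discr K).natAbs : ℝ) := by rw [Nat.cast_natAbs, Int.cast_abs]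
        have hd1 : (1 : ℝ) ≤ ((discr K).natAbs : ℝ) := by exact_mod_cast Int.natAbs_pos.mpr (discr_ne_zero K)
        have hf1 : (1 : ℝ) ≤ ((Ideal.absNorm Dψ.𝔣 : ℕ) : ℝ) := one_le_absNorm_cast Dψ.ne_bot
        have hcond : Real.log (|(discr K : ℝ)| * (Ideal.absNorm Dψ.𝔣 : ℝ)) ≤ logd := by
          rw [hdisc, hlogd]
          exact Real.log_le_log (by nlinarith) (mul_le_mul_of_nonneg_left Dψ.absNorm_le (by linarith))
        have : (Module.finrank ℚ K : ℝ) ≤ Q := hnQ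
        linarith
    have := mul_le_mul_of_nonneg_right hm hℓ0.le
    linarith
  · -- the left-line integral of `ζ_K`
    have h0 := norm_dzEFRemainder_windowTest_zero_le (K := K) hAl0 hAl hM hε0 hεlo hlohi
    refine h0.trans ?_
    have hd1 : (1 : ℝ) ≤ ((discr K).natAbs : ℝ) := by exact_mod_cast Int.natAbs_pos.mpr (discr_ne_zero K)
    have hm1 := one_le_absNorm_cast h𝔪
    have hle : Real.log ((discr K).natAbs : ℝ) ≤ logd := by
      rw [hlogd]; exact Real.log_le_log (by linarith) (by nlinarith)
    have hlogd0' : 0 ≤ Real.log ((discr K).natAbs : ℝ) := Real.log_natCast_nonneg _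
    have hlog40 : 0 ≤ Real.log 4 := Real.log_nonneg (by norm_num)
    have hpos : 0 ≤ Real.exp (-((lo - ε) / 2)) * (2 * M / ε) := by positivity
    have hn1 : (0 : ℝ) ≤ (n : ℝ) + 1 := by positivity
    rw [hKn]
    have h1 : leftLineConst * (Al * ((n : ℝ) + 1)) ≤ leftLineConst * (max Al Cr * ((n : ℝ) + 1)) :=
      mul_le_mul_of_nonneg_left (mul_le_mul_of_nonneg_right (le_max_left _ _) hn1) hlC
    have h2 : Real.log ((discr K).natAbs : ℝ) + Real.log 4 + 1 ≤ logd + Real.log 4 + 1 := by linarith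
    exact mul_le_mul (mul_le_mul h1 h2 (by linarith) (by positivity)) le_rfl hpos (by positivity)
  · -- the left-line integral of `L_ψ`
    set Dψ := datumData h𝔪 hray hsep ψ hψ with hDψ
    have hnt := charFun_nontrivial hsep hψ
    have h0 := norm_rcEFRemainder_windowTest_zero_le hCr0 hCr Dψ.isRayClassCharacter Dψ.isPrimitive Dψ.isSignType
      Dψ.ne_bot (Dψ.nontrivial hnt) Dψ.differentiable Dψ.L_eq Dψ.differentiable_Lconj (fun s hs ↦ Dψ.Lconj_eq hs)
      hM hε0 hεlo hlohi
    refine h0.trans ?_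
    have hdisc : |(discr K : ℝ)| = ((discr K).natAbs : ℝ) := by rw [Nat.cast_natAbs, Int.cast_abs]
    have hd1 : (1 : ℝ) ≤ ((discr K).natAbs : ℝ) := by exact_mod_cast Int.natAbs_pos.mpr (discr_ne_zero K)
    have hf1 : (1 : ℝ) ≤ ((Ideal.absNorm Dψ.𝔣 : ℕ) : ℝ) := one_le_absNorm_cast Dψ.ne_bot
    have hcond : Real.log (|(discr K : ℝ)| * (Ideal.absNorm Dψ.𝔣 : ℝ)) ≤ logd := by
      rw [hdisc, hlogd]
      exact Real.log_le_log (by nlinarith) (mul_le_mul_of_nonneg_left Dψ.absNorm_le (by linarith))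
    have hlogA0 : 0 ≤ Real.log (|(discr K : ℝ)| * (Ideal.absNorm Dψ.𝔣 : ℝ)) := by
      rw [hdisc]; exact Real.log_nonneg (by nlinarith)
    have hlog40 : 0 ≤ Real.log 4 := Real.log_nonneg (by norm_num)
    have hpos : 0 ≤ Real.exp (-((lo - ε) / 2)) * (2 * M / ε) := by positivity
    have hn1 : (0 : ℝ) ≤ (n : ℝ) + 1 := by positivity
    rw [hKn]
    have h1 : leftLineConst * (Cr * ((n : ℝ) + 1)) ≤ leftLineConst * (max Al Cr * ((n : ℝ) + 1)) :=
      mul_le_mul_of_nonneg_left (mul_le_mul_of_nonneg_right (le_max_right _ _) hn1) hlC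
    have h2 : Real.log (|(discr K : ℝ)| * (Ideal.absNorm Dψ.𝔣 : ℝ)) + Real.log 4 + 1 ≤ logd + Real.log 4 + 1 := by
      linarith
    exact mul_le_mul (mul_le_mul h1 h2 (by linarith) (by positivity)) le_rfl hpos (by positivity)
  -- the bookkeeping
  refine hsm.trans ?_
  rw [hcardG]
  have hbook := frobWindow_bookkeeping (W₀ := W₀) (A_L := max Al Cr) (AK := AK) (logd := logd) (nK := (n : ℝ))
    (hK := (Nat.card G : ℝ)) (κ₁ := 2 * Real.exp 1 * D * Real.exp (-(cZ / (6 * θ))))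
    (κ₂ := κ₂) (L := Real.log x) (ℓ := hi - lo + 2 * ε) (LX := hi + ε) (X := Real.exp (hi + ε))
    (T₁ := Real.exp (θ * (hi + ε))) (c := cZ) (a := a) (c₁ := tailConst₁) (c₂ := tailConst₂) (M := M)
    hQ12 hM1 hAC0 hW₀0 hlC hc₁16 hc₂0 hD hcZ ha hG (Nat.cast_nonneg _) hAKdef hAK4 hlogd0
    (by rw [← hKn]; exact hnQ) (Nat.cast_nonneg _) hθ0 hθ1 le_rfl haθ h2θ hη0 hη1 hηx hε₀0 hε₀1
    (by rw [hW₀] at hjunk ⊢; exact hjunk) hlo hlohi hhi hε rfl rfl rfl rfl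
  rw [hxexp] at hbook
  -- the imprimitive correction
  have hcorr : (Nat.card G : ℝ) * (2 * (hi + 2) * Real.log (Ideal.absNorm 𝔪 : ℕ)) ≤ κ₃ * x * η := by
    refine le_trans ?_ hjunk'
    have hlogm : 0 ≤ Real.log (Ideal.absNorm 𝔪 : ℕ) := Real.log_natCast_nonneg _
    refine mul_le_mul_of_nonneg_left ?_ (Nat.cast_nonneg _)
    exact mul_le_mul_of_nonneg_right (by linarith) hlogm
  have e : (Nat.card G : ℝ) * (64 * Q * (hi - lo + 2 * ε) +
      leftLineConst * (max Al Cr * ((n : ℝ) + 1)) * (logd + Real.log 4 + 1) *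
      (Real.exp (-((lo - ε) / 2)) * (2 * M / ε)) + 2 * (hi + 2) * Real.log (Ideal.absNorm 𝔪 : ℕ)) =
      (Nat.card G : ℝ) * (64 * Q * (hi - lo + 2 * ε) +
        leftLineConst * (max Al Cr * ((n : ℝ) + 1)) * (logd + Real.log 4 + 1) *
        (Real.exp (-((lo - ε) / 2)) * (2 * M / ε))) +
      (Nat.card G : ℝ) * (2 * (hi + 2) * Real.log (Ideal.absNorm 𝔪 : ℕ)) := by ring
  rw [e, ← add_assoc]
  have hfin : x * η * (9 / 2 * (2 * Real.exp 1 * D * Real.exp (-(cZ / (6 * θ)))) + κ₂) + κ₃ * x * η =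
      (9 / 2 * (2 * Real.exp 1 * D * Real.exp (-(cZ / (6 * θ)))) + κ₂ + κ₃) * x * η := by ring
  rw [← hfin]
  exact add_le_add hbook hcorr

end Summit.QuantumAdvantage.QuantumAdvantage.Theorems.DegreeOnePrimesEscape

end
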